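import Summits.QuantumFields.BalabanUV.Beta.HessKerDressedUnits
import Summits.QuantumFields.BalabanUV.Beta.GAN24.KernelLegCharges
import Literature.MathematicalPhysics.QuantumFieldTheory.Balaban1983to89.Beta.BalabanStepJetsSucc

/-!
# `BalabanUV.Beta.GAN24.SandwichLetterCharge` — binder row G-an2-4 ∕ (CONV-C), W-slot CT-W, route «WC-TL» ∕ (Q-R) «QR-LL», THE (S) ROW's `hQ` DICTIONARY
# (the END `WardRemainderEndThree.wLocStencil_unitS_of_layer ∕ …three`, row (CE) `hQ`; design `HOME/b2b-balaban-gan24-p1/gen28/WSM-DESIGN-v0.md` §1):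
# **THE PLAIN ff CHARGE OF A UNIT-CURRENCY SUPER-BLOCK SUM OF SANDWICH LETTERS IS THE FINITE LABEL SUM OF THE COARSE `(inr, inr)` PAIR-`HasSum` VALUES,
# TIMES ONE SCALAR** (row owner `b2b-balaban-gan24-p1`, gen 28)

NOT IN PRINT; OUR BOOKKEEPING ([folklore]: `unitS_apply` ∕ `legScale_inl` (asym-lineage units), `mmRead_inl_inl` (an3∕an4's `BalabanStepJetsSucc`), `Finset.sum_apply`,
`hasSum_sum`, `HasSum.mul_left`, and Mathlib's `Summable.tsum_prod` for the iterated form; 0 cited facts, 0 `def`, 0 `def … : Prop`, 0 sorry).  HONEST FRAMING (cell contract,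
verbatim): «discharging `BetaPertH` makes Bałaban's UV stability UNCONDITIONAL — a real constructive-QFT result; it is NOT the continuum limit and NOT the Clay problem.»
HONEST DEPENDENCY (verbatim): «continuum YM on T⁴ ⇐ BetaPertH ∧ nine spine estimates (0/9 proved); BetaPertH ⇐ (D1) ∧ (D4) ∧ CAP+tail; G-an2-4 gates asym, D1 and NE2/3/4.»

WHAT.  The END displays, per level `m`, the charge decomposition `hQ : Σ'_x Σ'_z S_m k′ u x z (inl κ₁)(inl κ₂) = Σ_{y′ ∈ Tl m} Z m k′ κ₁ κ₂ y′ u` for the LITERAL letter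
`S_m = unitS sf sm (Σ_{w ∈ box L} σ m (L•Y + w))`, `σ m Y′ κ′ u′ = c • Σ_{v ∈ box Lc} mmRead Lc (G_m ∘ Ψ m (Lc•Y′ + v) κ′ u′ ∘ G_m)` (p2 PART 5 `WardResidualSUnrolled`).  The (α)∕(γ)∕(β)
suppliers deliver, PER LABEL, the coarse pair-`HasSum` of the sandwich: `HasSum ((x′,z′) ↦ (G ∘ piece(y) ∘ G)(Lc•x′, Lc•z′)_{(inr α, inr β)}) (value)` (p2 `WardResidualRotatedVertexTransported`
§1, leaf-06 `GaugeReadChargeTransported ∕ …Comb`, leaf-02 `SymRMChargeFree`).  THIS FILE is the bookkeeping in between, for ABSTRACT sandwiched kernels `F i κ u`: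
§1 `unitS_inl_inl` (the ff entries of `unitS` carry the ONE scalar `(sf·sm)⁻¹·sf⁻²`), `smul_sum_mmRead_inl_inl`; §2 **`hasSum_prod_unitS_smul_sum_mmRead`** (pair-`HasSum` of the letter's
ff entries = scalar · `c` · Σ_{i∈T} values); §3 `tsum_tsum_eq_of_hasSum_prod` (pair `HasSum` ⇒ the END's ITERATED `Σ'_x Σ'_z`, no extra hypothesis: `Summable.tsum_prod`) and
**`tsum_tsum_unitS_smul_sum_mmRead`** = the `hQ` SHAPE: `Σ'_x Σ'_z (unitS sf sm (fun κ u ↦ c • Σ_{i∈T} mmRead N (F i κ u)) κ u) x z (inl α)(inl β) = Σ_{i∈T} ((sf·sm)⁻¹·(sf⁻¹·sf⁻¹)·c)·v i`;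
§4 `sum_smul_sum_mmRead` (the literal's TWO nested label sums — super-block `w`, block `v` — as ONE sum over `box L ×ˢ box Lc`, so §3 applies with `T :=` the product).
Asserts NO value of any charge; discharges NOTHING of (S) ∕ (Q-R) ∕ (LT) ∕ (Q-L) ∕ (C) ∕ «T2Shape» ∕ «T2Drift» ∕ (hW, hWall); NEVER «G-an2-4 closed» as (CONV-C); NOT D1, NOT `BetaPertH`, NOT continuum,
NOT Clay.  2026-08-22.
-/

noncomputable section

open Finset
open scoped BigOperators
open Literature.MathematicalPhysics.QuantumFieldTheory
open Literature.MathematicalPhysics.QuantumFieldTheory.Balaban1983to89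
open Literature.MathematicalPhysics.QuantumFieldTheory.Balaban1983to89.Beta
open ExpKernelCalculus (MKer Site)
open OneStepResolventKernel (Fib)
open BalabanStepJetsSucc (mmRead mmRead_inl_inl)
open Summit.QuantumFields.BalabanUV.Beta.HessKerDressedUnits (unitS unitS_apply legScale_inl)

namespace Summit.QuantumFields.BalabanUV.Beta.GAN24.SandwichLetterCharge

variable {d : ℕ}

/-! ## §1 The two entry formulas -/

/-- [folklore] The field–field entries of a unit-rescaled stencil table carry ONE scalar: `unitS sf sm S κ u x z (inl α)(inl β) = (sf·sm)⁻¹·(sf⁻¹·sf⁻¹)·S κ u x z (inl α)(inl β)`. -/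
theorem unitS_inl_inl (sf sm : ℝ) (S : Fin (d + 1) → Site (d + 1) → MKer (d + 1) (Fib d)) (κ : Fin (d + 1)) (u x z : Site (d + 1))
    (α β : Fin (d + 1)) :
    unitS sf sm S κ u x z (Sum.inl α) (Sum.inl β) = ((sf * sm)⁻¹ * (sf⁻¹ * sf⁻¹)) * S κ u x z (Sum.inl α) (Sum.inl β) := by
  rw [unitS_apply, legScale_inl, legScale_inl]
  ring

/-- [folklore] The field–field entries of the sandwich letter's slot value `c • Σ_{i∈T} mmRead N (F i)` are `c·Σ_{i∈T} F i (N•x′) (N•z′) (inr α)(inr β)`. -/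
theorem smul_sum_mmRead_inl_inl {ι : Type*} (T : Finset ι) (c : ℝ) (N : ℕ) (F : ι → MKer (d + 1) (Fib d)) (x z : Site (d + 1))
    (α β : Fin (d + 1)) :
    (c • ∑ i ∈ T, mmRead N (F i)) x z (Sum.inl α) (Sum.inl β) = c * ∑ i ∈ T, F i ((N : ℤ) • x) ((N : ℤ) • z) (Sum.inr α) (Sum.inr β) := by
  simp only [Pi.smul_apply, Finset.sum_apply, smul_eq_mul, mmRead_inl_inl]

/-! ## §2 The pair-`HasSum` of the letter's ff entries -/

/-- NOT IN PRINT; OUR BOOKKEEPING.  **THE COARSE PAIR-`HasSum` OF THE UNIT-CURRENCY SANDWICH LETTER**: if each sandwiched kernel `F i κ u` has the coarse `(inr, inr)` pair-`HasSum`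
value `v i` (the suppliers' theorems, per label `i`), then the ff entries of `unitS sf sm (fun κ u ↦ c • Σ_{i∈T} mmRead N (F i κ u)) κ u` have the pair-`HasSum`
`((sf·sm)⁻¹·(sf⁻¹·sf⁻¹))·(c·Σ_{i∈T} v i)`. -/
theorem hasSum_prod_unitS_smul_sum_mmRead {ι : Type*} (T : Finset ι) (sf sm c : ℝ) (N : ℕ)
    {F : ι → Fin (d + 1) → Site (d + 1) → MKer (d + 1) (Fib d)} {v : ι → ℝ} (κ : Fin (d + 1)) (u : Site (d + 1)) (α β : Fin (d + 1))
    (h : ∀ i ∈ T, HasSum (fun xz : Site (d + 1) × Site (d + 1) => F i κ u ((N : ℤ) • xz.1) ((N : ℤ) • xz.2) (Sum.inr α) (Sum.inr β)) (v i)) :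
    HasSum (fun xz : Site (d + 1) × Site (d + 1) =>
        unitS sf sm (fun κ u => c • ∑ i ∈ T, mmRead N (F i κ u)) κ u xz.1 xz.2 (Sum.inl α) (Sum.inl β))
      (((sf * sm)⁻¹ * (sf⁻¹ * sf⁻¹)) * (c * ∑ i ∈ T, v i)) := by
  have hs : HasSum (fun xz : Site (d + 1) × Site (d + 1) => ∑ i ∈ T, F i κ u ((N : ℤ) • xz.1) ((N : ℤ) • xz.2) (Sum.inr α) (Sum.inr β))
      (∑ i ∈ T, v i) := hasSum_sum h
  have h2 := (hs.mul_left c).mul_left ((sf * sm)⁻¹ * (sf⁻¹ * sf⁻¹))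
  refine h2.congr_fun fun xz => ?_
  rw [unitS_inl_inl, smul_sum_mmRead_inl_inl]

/-! ## §3 The iterated form — the END's `hQ` shape -/

/-- [folklore] A pair-`HasSum` over `Site × Site` gives the ITERATED double sum with the same value (`Summable.tsum_prod`, no further hypothesis). -/
theorem tsum_tsum_eq_of_hasSum_prod {f : Site (d + 1) → Site (d + 1) → ℝ} {v : ℝ}
    (h : HasSum (fun xz : Site (d + 1) × Site (d + 1) => f xz.1 xz.2) v) : ∑' x, ∑' z, f x z = v := by
  rw [← h.tsum_eq]
  exact (h.summable.tsum_prod).symm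

/-- NOT IN PRINT; OUR BOOKKEEPING.  **THE `hQ` SHAPE**: under the hypotheses of §2,
`Σ'_x Σ'_z (unitS sf sm (fun κ u ↦ c • Σ_{i∈T} mmRead N (F i κ u)) κ u) x z (inl α)(inl β) = Σ_{i∈T} ((sf·sm)⁻¹·(sf⁻¹·sf⁻¹)·c)·v i` — the decomposition over labels
`Z … i u := ((sf·sm)⁻¹·(sf⁻¹·sf⁻¹)·c)·v i` that `WardRemainderEndThree`'s `hQ` displays (with `Tl := T`, the labels' sites). -/
theorem tsum_tsum_unitS_smul_sum_mmRead {ι : Type*} (T : Finset ι) (sf sm c : ℝ) (N : ℕ)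
    {F : ι → Fin (d + 1) → Site (d + 1) → MKer (d + 1) (Fib d)} {v : ι → ℝ} (κ : Fin (d + 1)) (u : Site (d + 1)) (α β : Fin (d + 1))
    (h : ∀ i ∈ T, HasSum (fun xz : Site (d + 1) × Site (d + 1) => F i κ u ((N : ℤ) • xz.1) ((N : ℤ) • xz.2) (Sum.inr α) (Sum.inr β)) (v i)) :
    ∑' x, ∑' z, unitS sf sm (fun κ u => c • ∑ i ∈ T, mmRead N (F i κ u)) κ u x z (Sum.inl α) (Sum.inl β)
      = ∑ i ∈ T, ((sf * sm)⁻¹ * (sf⁻¹ * sf⁻¹) * c) * v i := by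
  have h1 := tsum_tsum_eq_of_hasSum_prod
    (f := fun x z => unitS sf sm (fun κ u => c • ∑ i ∈ T, mmRead N (F i κ u)) κ u x z (Sum.inl α) (Sum.inl β))
    (hasSum_prod_unitS_smul_sum_mmRead T sf sm c N κ u α β h)
  rw [h1, Finset.mul_sum, Finset.mul_sum]
  refine Finset.sum_congr rfl fun i _ => ?_
  ring

/-! ## §4 The literal's two nested label sums as one -/

/-- [folklore] **SUPER-BLOCK ∘ BLOCK = ONE LABEL SET**: `Σ_{w∈W} (fun κ u ↦ c • Σ_{v∈V} mmRead N (F w v κ u)) = fun κ u ↦ c • Σ_{p ∈ W ×ˢ V} mmRead N (F p.1 p.2 κ u)` —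
so p2 PART 5's letter summed over the super-block (`W = box L` of `L•Y + w`, `V = box Lc` of `Lc•(·) + v`) is §2–§3's shape with `T := W ×ˢ V`. -/
theorem sum_smul_sum_mmRead {ιw ιv : Type*} (W : Finset ιw) (V : Finset ιv) (c : ℝ) (N : ℕ)
    (F : ιw → ιv → Fin (d + 1) → Site (d + 1) → MKer (d + 1) (Fib d)) :
    (∑ w ∈ W, fun κ u => c • ∑ v ∈ V, mmRead N (F w v κ u))
      = fun κ u => c • ∑ p ∈ W ×ˢ V, mmRead N (F p.1 p.2 κ u) := by
  funext κ u
  simp only [Finset.sum_apply, Finset.smul_sum, Finset.sum_product]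

/-- NOT IN PRINT; OUR BOOKKEEPING.  **THE `hQ` SHAPE FOR THE LITERAL's NESTED SUMS**: for sandwiched kernels `F w v κ u` indexed by the super-block label `w ∈ W` and the block
label `v ∈ V`, with coarse pair-`HasSum` values `val w v`,
`Σ'_x Σ'_z (unitS sf sm (Σ_{w∈W} fun κ u ↦ c • Σ_{v∈V} mmRead N (F w v κ u)) κ u) x z (inl α)(inl β) = Σ_{p ∈ W ×ˢ V} ((sf·sm)⁻¹·(sf⁻¹·sf⁻¹)·c)·val p.1 p.2`. -/
theorem tsum_tsum_unitS_superBlock {ιw ιv : Type*} (W : Finset ιw) (V : Finset ιv) (sf sm c : ℝ) (N : ℕ)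
    {F : ιw → ιv → Fin (d + 1) → Site (d + 1) → MKer (d + 1) (Fib d)} {val : ιw → ιv → ℝ} (κ : Fin (d + 1)) (u : Site (d + 1)) (α β : Fin (d + 1))
    (h : ∀ w ∈ W, ∀ v ∈ V, HasSum (fun xz : Site (d + 1) × Site (d + 1) => F w v κ u ((N : ℤ) • xz.1) ((N : ℤ) • xz.2) (Sum.inr α) (Sum.inr β)) (val w v)) :
    ∑' x, ∑' z, unitS sf sm (∑ w ∈ W, fun κ u => c • ∑ v ∈ V, mmRead N (F w v κ u)) κ u x z (Sum.inl α) (Sum.inl β)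
      = ∑ p ∈ W ×ˢ V, ((sf * sm)⁻¹ * (sf⁻¹ * sf⁻¹) * c) * val p.1 p.2 := by
  rw [sum_smul_sum_mmRead]
  exact tsum_tsum_unitS_smul_sum_mmRead (W ×ˢ V) sf sm c N (F := fun p => F p.1 p.2) (v := fun p => val p.1 p.2) κ u α β
    fun p hp => h p.1 (Finset.mem_product.1 hp).1 p.2 (Finset.mem_product.1 hp).2

end Summit.QuantumFields.BalabanUV.Beta.GAN24.SandwichLetterCharge

end
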